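import Summits.BirchSwinnertonDyer.Rank1Residual.X11b.Three.UnramifiedClassCoboundary
import Summits.BirchSwinnertonDyer.Rank1Residual.X11b.Three.UnramifiedClassCuspLift
import Summits.BirchSwinnertonDyer.Rank1Residual.X11b.Three.KolyvaginClassBadPlaceEnd
import HarnessLib

/-!
# X11b at `p = 3` (team N8/O2), S15 additive places, (C1) road: unramified `E₀`-valued classes of
# `H¹(K_v, E)` vanish at a place of ADDITIVE reduction (Milne ADT I.3.8 for `𝒜°` at a cusp), and
# Gross 1991 Prop. 6.2 (1) for Kolyvagin's point there with `hvanish` DISCHARGED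

HONEST FRAMING (cell `b2b-bsdres`, run/shared/lean/b2b/bsd-rank1-residual/, verbatim in every
file): the goal of the cell is to DELETE the COMBINATION-SHAPED residual classes of the
Birch–Swinnerton-Dyer formula for ALL analytic-rank `≤ 1` elliptic curves over `ℚ` — "full BSD
formula for every rank `≤ 1` curve in class `C`" assembled STRICTLY from published theorems — so
that the rank-`≤ 1` remainder becomes exactly the CONSTRUCTION-SHAPED classes, which are TYPED
(missing-input `Prop`s), NOT attempted. This is not "finishing BSD". Team N8/O2 = `x11b3`, seat
`b2b-bsdres-x11b3-p8` (GEN 3), LEAD DEAL #7 R7-35 item (3). LABEL OF RECORD: flag-discharge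
hygiene for `JET@p|N` (harvest E66 (D)) — NOT count-moving; nothing is booked; `O2` OPEN.
THEOREMS ONLY: no definition, no named fact, no `sorry`.

## What

The additive-place twin of the cell's `UnramifiedClassNode` + `KolyvaginClassMultiplicativePlace`
(p8; p256686, p257318), assembled from `UnramifiedClassCoboundary.exists_eq_map_sub_of_cocycle_of_lift`
(Milne's Steps 2–4, place-agnostic) and `UnramifiedClassCuspLift.exists_lift_sub_mem_kernel_of_hasAdditiveReductionAt`
(Step 1 at a cusp; provider of the cusp map: x11b3-p4, parts 12/14):

* `exists_eq_map_sub_of_cocycle_of_hasAdditiveReductionAt` (model form): `E₀`-valued crossed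
  homomorphisms `Γ_{K_v} → V(K̄_v)` with open zero set vanishing on `I_𝔐` are principal.
* `oneCocycleClass_eq_zero_of_hasAdditiveReductionAt_of_forall` (curve form) and
  `oneCocycleClass_eq_zero_of_hasAdditiveReductionAt` (subgroup form = x11b3-p1's `hvanish` for
  every `B ≤ E(K̄_v)` contained in `E₀`, at an additive place).
* `kolyvaginClass_kolyvaginPoint_mem_selmerLocalKer_of_GZ31_of_hasAdditiveReductionAt`: p1's END
  FORM (p254200) verbatim with `hvanish` replaced by `hadd : W.HasAdditiveReductionAt v` + `hB`
  (+ the tree witnesses `w`, `ι`, `C`).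

With `UnramifiedClassNode` (multiplicative `v`) and the tree's `Milne2006_unramifiedClass_eq_zero_holds`
(good `v`, `B` arbitrary), the END FORM's (α) is now a theorem for `B ⊆ E₀` at EVERY finite place.

HONEST CONSEQUENCE (LEAD R7-16a (3) / R7-35): NOT a discharge of `JET@p|N`. At an additive place
the component group `Φ_v` has order `c_v ≤ 4` — including `c_v = 3` (Kodaira IV, IV*) — and all of
that content sits in "the Kolyvagin cocycle is `B ⊆ E₀`-valued" = the binder `hGZ31` ([GZ86,
III (3.1)]) of p1's (iv); no Tamagawa hypothesis appears here BECAUSE the receptacle is `E₀`.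
The flag stays; nothing is booked.

References (locators only; no cited FACT): [cite: MilneADT2006, Ch. I Prop. 3.8]
[cite: GrossLMS1991, Prop. 6.2 (1), pp. 244–245] [cite: GrossZagier1986, III (3.1)]
[cite: SilvermanAEC2009, Prop. VII.2.1, Prop. III.2.5(b)]; cell files p255910, p256222,
`UnramifiedClassCuspLift` (p8), p254200 (p1), parts 12/14 (p4).

## Design

`noncomputable section`; no definitions; no local notation. Namespace
`Summit.BirchSwinnertonDyer.Rank1Residual.X11b.Three.UnramifiedNode`. Axioms: `propext`,
`Classical.choice`, `Quot.sound`.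
-/


noncomputable section

open scoped Classical NNReal Topology
open NumberField IsDedekindDomain Field Polynomial ValuativeRel

universe u

namespace Summit.BirchSwinnertonDyer.Rank1Residual.X11b.Three.UnramifiedNode

open WeierstrassCurve Literature.NumberTheory.EllipticCurves
  Literature.NumberTheory.EllipticCurves.FormalGroupChart
  Literature.NumberTheory.GaloisRepresentations
  Literature.NumberTheory.GaloisRepresentations.IsNonarchimedeanLocalField IsDedekindDomain.HeightOneSpectrum

variable {K : Type u} [Field K] [NumberField K] (W : WeierstrassCurve K) {v : HeightOneSpectrum (𝓞 K)}
  {w : Valuation (AlgebraicClosure (v.adicCompletion K)) ℝ≥0}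
  (hw : ∀ x, (w x : ℝ) = spectralNorm (v.adicCompletion K) (AlgebraicClosure (v.adicCompletion K)) x)
  {ι : v.adicCompletionIntegers K →+* w.integer}
  (hι : ∀ a, ((ι a : w.integer) : AlgebraicClosure (v.adicCompletion K)) =
    algebraMap (v.adicCompletion K) (AlgebraicClosure (v.adicCompletion K)) (a : v.adicCompletion K))

/-! ### §1 Model form: `E₀`-valued unramified crossed homomorphisms into `V(K̄_v)` are principal -/

include hw in
/-- **Milne ADT I.3.8 for `E₀` at a place of additive reduction, model form.** For `W/K`
elliptic with additive reduction at `v`, every crossed homomorphism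
`g : Γ_{K_v} → V(K̄_v)` (`V = M ⊗ K̄_v`, `M = W.localMinimalIntegralModel v`) with open zero set,
vanishing on the inertia group `I_𝔐`, and with values of nonsingular reduction on the
`𝒪_w`-model `M.map ι` (`E₀`-valued), is principal: `g σ = σP - P`. Assembly of
`exists_eq_map_sub_of_cocycle_of_lift` (Steps 2–4) with the cusp lift
`exists_lift_sub_mem_kernel_of_hasAdditiveReductionAt` (Step 1).
[cite: MilneADT2006, Ch. I Prop. 3.8] [cite: GrossLMS1991, Prop. 6.2 (1), p. 244] -/
theorem exists_eq_map_sub_of_cocycle_of_hasAdditiveReductionAt [W.IsElliptic]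
    (hadd : W.HasAdditiveReductionAt v)
    {𝔐 : Ideal v.localAbsIntegers} (h𝔐 : 𝔐 ∈ v.localPrimesAbove)
    [hV : ((((W.localMinimalIntegralModel v).map (algebraMap (v.adicCompletionIntegers K) (v.adicCompletion K))).baseChange (AlgebraicClosure (v.adicCompletion K)))).IsIntegral w.integer]
    (hι : ∀ a, ((ι a : w.integer) : AlgebraicClosure (v.adicCompletion K)) =
      algebraMap (v.adicCompletion K) (AlgebraicClosure (v.adicCompletion K)) (a : v.adicCompletion K))
    (g : absoluteGaloisGroup (v.adicCompletion K) → ((((W.localMinimalIntegralModel v).map (algebraMap (v.adicCompletionIntegers K) (v.adicCompletion K))).baseChange (AlgebraicClosure (v.adicCompletion K)))).toAffine.Point)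
    (hg : ∀ σ τ, g (σ * τ) = g σ + WeierstrassCurve.Affine.Point.map (W' := (W.localMinimalIntegralModel v).map (algebraMap (v.adicCompletionIntegers K) (v.adicCompletion K))) ((absoluteGaloisGroup.toAlgEquiv (v.adicCompletion K) (σ) : AlgebraicClosure (v.adicCompletion K) ≃ₐ[v.adicCompletion K] AlgebraicClosure (v.adicCompletion K)) : AlgebraicClosure (v.adicCompletion K) →ₐ[v.adicCompletion K] AlgebraicClosure (v.adicCompletion K)) (g τ))
    (hopen : IsOpen {σ | g σ = 0})
    (hI : ∀ τ ∈ 𝔐.inertia (absoluteGaloisGroup (v.adicCompletion K)), g τ = 0)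
    (hE₀ : ∀ σ, ((W.localMinimalIntegralModel v).map ι).HasNonsingularReduction
      (Affine.Point.congrEquiv (baseChange_map_eq_baseChange_map hι (W.localMinimalIntegralModel v)) (g σ))) :
    ∃ P : ((((W.localMinimalIntegralModel v).map (algebraMap (v.adicCompletionIntegers K) (v.adicCompletion K))).baseChange (AlgebraicClosure (v.adicCompletion K)))).toAffine.Point, ∀ σ, g σ = WeierstrassCurve.Affine.Point.map (W' := (W.localMinimalIntegralModel v).map (algebraMap (v.adicCompletionIntegers K) (v.adicCompletion K))) ((absoluteGaloisGroup.toAlgEquiv (v.adicCompletion K) (σ) : AlgebraicClosure (v.adicCompletion K) ≃ₐ[v.adicCompletion K] AlgebraicClosure (v.adicCompletion K)) : AlgebraicClosure (v.adicCompletion K) →ₐ[v.adicCompletion K] AlgebraicClosure (v.adicCompletion K)) P - P :=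
  exists_eq_map_sub_of_cocycle_of_lift W hw h𝔐 g hg hopen hI fun φ hφq ↦
    exists_lift_sub_mem_kernel_of_hasAdditiveReductionAt hw hι W hadd h𝔐 hφq (g φ) (hE₀ φ)

/-! ### §2 Curve form: `E₀`-valued unramified classes of `H¹(K_v, E)` vanish -/

include hw in
/-- **Milne ADT I.3.8 for `E₀` at a place of additive reduction, curve form** (the shape of
the tree's `Milne2006_unramifiedClass_eq_zero` with the `E₀`-condition): a continuous crossed
homomorphism `f : Γ_{K_v} → E(K̄_v) = localPoints W K_v` vanishing on `I_𝔐`, all of whose values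
have nonsingular reduction on the minimal model (read through the tree's equivariant transport
`Φ : E(K̄_v) ≃ V(K̄_v)` of `Milne2006_unramifiedClass_eq_zero_holds`, determined by the variable
change `C` to the minimal model, and the `𝒪_w`-model along `ι`), has trivial class in
`H¹(K_v, E)`. The spectral valuation `w`, the structure map `ι` and `C` are the tree's witnesses
(`exists_spectralValuation`, `exists_ringHom_adicCompletionIntegers_integer`,
`exists_variableChange_eq_localMinimalIntegralModel`). [cite: MilneADT2006, Ch. I Prop. 3.8]
[cite: GrossLMS1991, Prop. 6.2 (1), p. 244] -/
theorem oneCocycleClass_eq_zero_of_hasAdditiveReductionAt_of_forall [W.IsElliptic]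
    (hadd : W.HasAdditiveReductionAt v)
    {𝔐 : Ideal v.localAbsIntegers} (h𝔐 : 𝔐 ∈ v.localPrimesAbove)
    (hι : ∀ a, ((ι a : w.integer) : AlgebraicClosure (v.adicCompletion K)) =
      algebraMap (v.adicCompletion K) (AlgebraicClosure (v.adicCompletion K)) (a : v.adicCompletion K))
    {C : VariableChange (v.adicCompletion K)}
    (hC : C • W.baseChange (v.adicCompletion K) =
      (W.localMinimalIntegralModel v).map (algebraMap (v.adicCompletionIntegers K) (v.adicCompletion K)))
    (f : contOneCocycles (discreteTopRep (absoluteGaloisGroup (v.adicCompletion K))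
      (localPoints W (v.adicCompletion K))))
    (hfE₀ : ∀ σ, ((W.localMinimalIntegralModel v).map ι).HasNonsingularReduction
      (Affine.Point.congrEquiv (baseChange_map_eq_baseChange_map hι (W.localMinimalIntegralModel v))
        (Affine.Point.congrEquiv (congrArg (fun X : WeierstrassCurve (v.adicCompletion K) ↦
            X.baseChange (AlgebraicClosure (v.adicCompletion K))) hC)
          (VariableChange.pointEquivBaseChange (W.baseChange (v.adicCompletion K)) C
            (AlgebraicClosure (v.adicCompletion K))
            (Affine.Point.congrEquiv (baseChange_baseChange_adicCompletion W v).symm (f.1 σ))))))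
    (hfI : ∀ τ ∈ 𝔐.inertia (absoluteGaloisGroup (v.adicCompletion K)), f.1 τ = 0) :
    oneCocycleClass (discreteTopRep (absoluteGaloisGroup (v.adicCompletion K))
      (localPoints W (v.adicCompletion K))) f = 0 := by
  haveI := WeierstrassCurve.isIntegral_spectralValuation_baseChange hw (W.localMinimalIntegralModel v)
  have hC' := congrArg (fun X : WeierstrassCurve (v.adicCompletion K) ↦
    X.baseChange (AlgebraicClosure (v.adicCompletion K))) hC
  -- the equivariant transport `E(K̄_v) ≃ V(K̄_v)` (as in `Milne2006_unramifiedClass_eq_zero_holds`)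
  let Φ : localPoints W (v.adicCompletion K) ≃+
      (((W.localMinimalIntegralModel v).map (algebraMap (v.adicCompletionIntegers K)
        (v.adicCompletion K))).baseChange (AlgebraicClosure (v.adicCompletion K))).toAffine.Point :=
    ((WeierstrassCurve.Affine.Point.congrEquiv (WeierstrassCurve.baseChange_baseChange_adicCompletion W v).symm).trans
      (WeierstrassCurve.VariableChange.pointEquivBaseChange (W.baseChange (v.adicCompletion K)) C
        (AlgebraicClosure (v.adicCompletion K)))).trans
      (WeierstrassCurve.Affine.Point.congrEquiv hC')
  have hΦ : ∀ (σ : absoluteGaloisGroup (v.adicCompletion K)) (Q : localPoints W (v.adicCompletion K)),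
      Φ (σ • Q) = WeierstrassCurve.Affine.Point.map ((absoluteGaloisGroup.toAlgEquiv (v.adicCompletion K) σ :
          AlgebraicClosure (v.adicCompletion K) ≃ₐ[v.adicCompletion K] AlgebraicClosure (v.adicCompletion K)) :
          AlgebraicClosure (v.adicCompletion K) →ₐ[v.adicCompletion K] AlgebraicClosure (v.adicCompletion K))
        (Φ Q) := by
    intro σ Q
    change WeierstrassCurve.Affine.Point.congrEquiv hC' (WeierstrassCurve.VariableChange.pointEquivBaseChange (W.baseChange (v.adicCompletion K)) C
        (AlgebraicClosure (v.adicCompletion K))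
        (WeierstrassCurve.Affine.Point.congrEquiv (WeierstrassCurve.baseChange_baseChange_adicCompletion W v).symm (σ • Q))) =
      WeierstrassCurve.Affine.Point.map _ (WeierstrassCurve.Affine.Point.congrEquiv hC'
        (WeierstrassCurve.VariableChange.pointEquivBaseChange (W.baseChange (v.adicCompletion K)) C
          (AlgebraicClosure (v.adicCompletion K))
          (WeierstrassCurve.Affine.Point.congrEquiv (WeierstrassCurve.baseChange_baseChange_adicCompletion W v).symm Q)))
    rw [WeierstrassCurve.congrEquiv_smul, WeierstrassCurve.VariableChange.pointEquivBaseChange_map_algEquiv]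
    exact WeierstrassCurve.Affine.Point.congrEquiv_baseChange_map hC _ _
  -- the transported crossed homomorphism
  set g : absoluteGaloisGroup (v.adicCompletion K) → _ := fun σ ↦ Φ (f.1 σ) with hgdef
  have hg : ∀ σ τ, g (σ * τ) = g σ + WeierstrassCurve.Affine.Point.map ((absoluteGaloisGroup.toAlgEquiv (v.adicCompletion K) σ :
      AlgebraicClosure (v.adicCompletion K) ≃ₐ[v.adicCompletion K] AlgebraicClosure (v.adicCompletion K)) :
      AlgebraicClosure (v.adicCompletion K) →ₐ[v.adicCompletion K] AlgebraicClosure (v.adicCompletion K)) (g τ) := by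
    intro σ τ
    simp only [hgdef]
    rw [f.2 σ τ, map_add, discreteTopRep_ρ_apply, hΦ]
  have hopen : IsOpen {σ | g σ = 0} := by
    have e : {σ | g σ = 0} = f.1 ⁻¹' {0} := by
      ext σ
      simp only [hgdef, Set.mem_setOf_eq, Set.mem_preimage, Set.mem_singleton_iff]
      exact Φ.map_eq_zero_iff
    rw [e]
    exact (isOpen_discrete _).preimage f.1.continuous
  have hI : ∀ τ ∈ 𝔐.inertia (absoluteGaloisGroup (v.adicCompletion K)), g τ = 0 := fun τ hτ ↦ by
    simp only [hgdef, hfI τ hτ, map_zero]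
  have hE₀ : ∀ σ, ((W.localMinimalIntegralModel v).map ι).HasNonsingularReduction
      (Affine.Point.congrEquiv (baseChange_map_eq_baseChange_map hι (W.localMinimalIntegralModel v)) (g σ)) :=
    fun σ ↦ hfE₀ σ
  obtain ⟨P, hP⟩ := exists_eq_map_sub_of_cocycle_of_hasAdditiveReductionAt W hw hadd h𝔐 hι g hg hopen hI hE₀
  rw [oneCocycleClass_eq_zero_iff]
  refine ⟨Φ.symm P, fun σ ↦ Φ.injective ?_⟩
  rw [discreteTopRep_ρ_apply, map_sub, hΦ, AddEquiv.apply_symm_apply]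
  exact hP σ

include hw in
/-- **`hvanish` of the END FORM, as a theorem at additive places** (Milne ADT I.3.8 for
`𝒜° = E₀`; Gross 1991 p. 244, "`H¹(K_λ^{un}/K_λ, E⁰) = 0`"): for every subgroup `B ≤ E(K̄_v)`
consisting of points with nonsingular reduction on the minimal model at `v` (read through the
transport `Φ`), every continuous crossed homomorphism `f : Γ_{K_v} → E(K̄_v)` with values in `B`
and vanishing on the inertia group `I_𝔐` has trivial class in `H¹(K_v, E)` — the hypothesis
`hvanish` of x11b3-p1's `kolyvaginClass_kolyvaginPoint_mem_selmerLocalKer_of_GZ31` (p254200) for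
`B ⊆ E⁰(K̄_v)`, with no residual layer hypothesis. It does NOT discharge `JET@p|N`: that the
Kolyvagin cocycle IS `B`-valued is the (iv)/(A)/(B) step (binder `hGZ31`, [GZ86, III (3.1)]), where
all the `c_v` / component-group content lives (LEAD R7-16a (3)). [cite: MilneADT2006, Ch. I Prop. 3.8]
[cite: GrossLMS1991, Prop. 6.2 (1), pp. 244–245] -/
theorem oneCocycleClass_eq_zero_of_hasAdditiveReductionAt [W.IsElliptic]
    (hadd : W.HasAdditiveReductionAt v)
    {𝔐 : Ideal v.localAbsIntegers} (h𝔐 : 𝔐 ∈ v.localPrimesAbove)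
    (hι : ∀ a, ((ι a : w.integer) : AlgebraicClosure (v.adicCompletion K)) =
      algebraMap (v.adicCompletion K) (AlgebraicClosure (v.adicCompletion K)) (a : v.adicCompletion K))
    {C : VariableChange (v.adicCompletion K)}
    (hC : C • W.baseChange (v.adicCompletion K) =
      (W.localMinimalIntegralModel v).map (algebraMap (v.adicCompletionIntegers K) (v.adicCompletion K)))
    (B : AddSubgroup (localPoints W (v.adicCompletion K)))
    (hB : ∀ Q ∈ B, ((W.localMinimalIntegralModel v).map ι).HasNonsingularReduction
      (Affine.Point.congrEquiv (baseChange_map_eq_baseChange_map hι (W.localMinimalIntegralModel v))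
        (Affine.Point.congrEquiv (congrArg (fun X : WeierstrassCurve (v.adicCompletion K) ↦
            X.baseChange (AlgebraicClosure (v.adicCompletion K))) hC)
          (VariableChange.pointEquivBaseChange (W.baseChange (v.adicCompletion K)) C
            (AlgebraicClosure (v.adicCompletion K))
            (Affine.Point.congrEquiv (baseChange_baseChange_adicCompletion W v).symm Q)))))
    (f : contOneCocycles (discreteTopRep (absoluteGaloisGroup (v.adicCompletion K))
      (localPoints W (v.adicCompletion K))))
    (hfB : ∀ τ, f.1 τ ∈ B)
    (hfI : ∀ τ ∈ 𝔐.inertia (absoluteGaloisGroup (v.adicCompletion K)), f.1 τ = 0) :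
    oneCocycleClass (discreteTopRep (absoluteGaloisGroup (v.adicCompletion K))
      (localPoints W (v.adicCompletion K))) f = 0 :=
  oneCocycleClass_eq_zero_of_hasAdditiveReductionAt_of_forall W hw hadd h𝔐 hι hC f
    (fun σ ↦ hB _ (hfB σ)) hfI

end Summit.BirchSwinnertonDyer.Rank1Residual.X11b.Three.UnramifiedNode

end


noncomputable section

open scoped Classical NNReal
open scoped AddSubgroup

namespace Summit.BirchSwinnertonDyer.Rank1Residual.X11b.Three.UnramifiedNode

open WeierstrassCurve NumberField IsDedekindDomain Field
  Literature.NumberTheory.EllipticCurves Literature.NumberTheory.EllipticCurves.KolyvaginCocycle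
  Literature.NumberTheory.EllipticCurves.KolyvaginEuler Literature.NumberTheory.GaloisRepresentations
  Summit.BirchSwinnertonDyer.Rank1Residual.X11b.Three.KolyvaginRoot
  Summit.BirchSwinnertonDyer.Rank1Residual.X11b.Three.GrossBadPlace IsDedekindDomain.HeightOneSpectrum

universe u

variable {K : Type u} [Field K] [NumberField K] (W : WeierstrassCurve K) {n : ℤ}
variable {hdiv : ∀ P : geomPoints W, ∃ Q : geomPoints W, n • Q = P}
variable {𝒢 : Type*} [CommGroup 𝒢] {A₀ : Type*} [AddCommGroup A₀] [DistribMulAction 𝒢 A₀]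

/-- **Gross 1991, Prop. 6.2 (1) for Kolyvagin's point `P_n` at a place of ADDITIVE reduction
of `E`, with (α) PROVED**: x11b3-p1's END FORM with its hypothesis `hvanish` discharged by Milne
*ADT* I.3.8 for `E₀` at a cusp (`oneCocycleClass_eq_zero_of_hasAdditiveReductionAt`), for any
receptacle `B ≤ E(K̄_v)` whose points have nonsingular reduction on the minimal model at `v`
(hypothesis `hB`, read through the tree's transport determined by `C`, `ι`, `w`). Carried: the
Euler-system data, admissibility, inertia fixing `jP_n`, and `hGZ31` ([GZ86, III (3.1)] via Gross
p. 245, cite-only) — where all component-group content lives; `JET@p|N` is NOT discharged.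
[cite: GrossLMS1991, Prop. 6.2 (1), pp. 244–245] [cite: GrossZagier1986, III (3.1)]
[cite: MilneADT2006, Ch. I Prop. 3.8] -/
theorem kolyvaginClass_kolyvaginPoint_mem_selmerLocalKer_of_GZ31_of_hasAdditiveReductionAt
    [W.IsElliptic]
    {σ : ℕ → 𝒢} {L : Finset ℕ} {H : Subgroup 𝒢} [Fintype (𝒢 ⧸ H)] {f : 𝒢 ⧸ H → 𝒢}
    (hf : ∀ q, (f q : 𝒢 ⧸ H) = q) (hgen : H ≤ Subgroup.closure (σ '' (L : Set ℕ)))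
    (hord : ∀ ℓ ∈ L, σ ℓ ^ (ℓ + 1) = 1) (hdvd : ∀ ℓ ∈ L, n ∣ ((ℓ + 1 : ℕ) : ℤ)) {y : A₀}
    (π : absoluteGaloisGroup K →* 𝒢) (j : A₀ →+ geomPoints W)
    (hj : ∀ (g : absoluteGaloisGroup K) (a : A₀), j (π g • a) = g • j a)
    (hA : IsAdmissible (absoluteGaloisGroup K) j.range n)
    (hP : j (kolyvaginPoint σ L f y) ∈ invPoints (absoluteGaloisGroup K) j.range n)
    -- the place: additive reduction
    (v : HeightOneSpectrum (𝓞 K)) (hadd : W.HasAdditiveReductionAt v)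
    {𝔐 : Ideal (v.localAbsIntegers)} (h𝔐 : 𝔐 ∈ v.localPrimesAbove)
    (hI : ∀ τ ∈ 𝔐.inertia (absoluteGaloisGroup (v.adicCompletion K)),
      resGal (K := K) (v.adicCompletion K) τ • j (kolyvaginPoint σ L f y) =
        j (kolyvaginPoint σ L f y))
    -- the transport data (tree witnesses) and the receptacle `B ⊆ E₀`
    {w : Valuation (AlgebraicClosure (v.adicCompletion K)) ℝ≥0}
    (hw : ∀ x, (w x : ℝ) = spectralNorm (v.adicCompletion K) (AlgebraicClosure (v.adicCompletion K)) x)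
    {ι : v.adicCompletionIntegers K →+* w.integer}
    (hι : ∀ a, ((ι a : w.integer) : AlgebraicClosure (v.adicCompletion K)) =
      algebraMap (v.adicCompletion K) (AlgebraicClosure (v.adicCompletion K)) (a : v.adicCompletion K))
    {C : VariableChange (v.adicCompletion K)}
    (hC : C • W.baseChange (v.adicCompletion K) =
      (W.localMinimalIntegralModel v).map (algebraMap (v.adicCompletionIntegers K) (v.adicCompletion K)))
    {E' : AddSubgroup A₀} (B : AddSubgroup (localPoints W (v.adicCompletion K))) {n' : ℤ}
    (hB : ∀ Q ∈ B, ((W.localMinimalIntegralModel v).map ι).HasNonsingularReduction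
      (Affine.Point.congrEquiv (baseChange_map_eq_baseChange_map hι (W.localMinimalIntegralModel v))
        (Affine.Point.congrEquiv (congrArg (fun X : WeierstrassCurve (v.adicCompletion K) ↦
            X.baseChange (AlgebraicClosure (v.adicCompletion K))) hC)
          (VariableChange.pointEquivBaseChange (W.baseChange (v.adicCompletion K)) C
            (AlgebraicClosure (v.adicCompletion K))
            (Affine.Point.congrEquiv (baseChange_baseChange_adicCompletion W v).symm Q)))))
    -- hGZ31 (= [GZ86, III (3.1)] via Gross 1991 p. 245; cite-only)
    (hGZ31 : (∀ (γ : 𝒢), ∀ e ∈ E', γ • e ∈ E') ∧ y ∈ E' ∧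
      (∀ ℓ ∈ L, grAct A₀ (traceElt (σ ℓ) ℓ) y ∈ E'.map (zsmulAddGroupHom n : A₀ →+ A₀)) ∧
      ∀ x ∈ E', n' • pointsMap W (v.adicCompletion K) (j x) ∈ B)
    (hcop : IsCoprime n n') :
    kolyvaginClass W n hdiv hA (j (kolyvaginPoint σ L f y)) hP ∈
      selmerLocalKer W (v.adicCompletion K) n :=
  kolyvaginClass_kolyvaginPoint_mem_selmerLocalKer_of_GZ31 W hf hgen hord hdvd π j hj hA hP v hI B
    hGZ31 hcop fun c hcB hcI ↦
      oneCocycleClass_eq_zero_of_hasAdditiveReductionAt W hw hadd h𝔐 hι hC B hB c hcB hcI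

end Summit.BirchSwinnertonDyer.Rank1Residual.X11b.Three.UnramifiedNode

end
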